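import Mathlib
import Summits.AnomalousDissipation.AnomalousDissipation.Theorems.SoloBlindLiftoffFarField

/-!
# Classification of the solutions of `m''' = m` and uniqueness of the bounded inverse of `1 - ∂³` — kernel #115 (solo-blind s64)

Kernel #112 (`SoloBlindSmoothingGreen`) built the bounded Green's function of the third-order
join rule `m - m''' = g` (the quantitative smoothing rule behind the composite solutions of the
reduced steady problem), and kernel #113 (`SoloBlindLiftoffFarField`, part B) proved that a
bounded member of the explicit family `a e^{η} + e^{-η/2} (b cos(√3 η/2) + c sin(√3 η/2))`
vanishes. The dimension count left open there ("every `C³` solution of `m''' = m` lies in the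
family") is closed here, so that the uniqueness statement no longer carries the proviso
"within the family":

1. the family is closed under differentiation, with coefficient map
   `(a, b, c) ↦ (a, -b/2 + (√3/2) c, -c/2 - (√3/2) b)`, which has order three;
2. (Picard–Lindelöf) every triple `m, m₁, m₂ : ℝ → ℝ` with `m' = m₁`, `m₁' = m₂`, `m₂' = m` on `ℝ`
   satisfies `m = family (a, b, c)` with `a = (m 0 + m₁ 0 + m₂ 0)/3`, `b = (2 m 0 - m₁ 0 - m₂ 0)/3`,
   `c = √3 (m₁ 0 - m₂ 0)/3` — Mathlib's `ODE_solution_unique_univ` applied to the first-order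
   system `(m, m₁, m₂)' = (m₁, m₂, m)` on `ℝ × ℝ × ℝ`, whose vector field is a coordinate
   permutation and hence `1`-Lipschitz;
3. hence a bounded solution of `m''' = m` on `ℝ` is identically zero (with kernel #113), and
4. two bounded solutions of `m - m''' = g` on `ℝ` coincide: the bounded inverse of `1 - ∂³` of
   kernel #112 is unique.
-/

namespace Summit.AnomalousDissipation.AnomalousDissipation.Theorems

open Real Set

/-- The explicit three-parameter family of real solutions of `m''' = m`. -/
noncomputable def smoothingHom (a b c : ℝ) (η : ℝ) : ℝ :=
  a * exp η + exp (-η / 2) * (b * cos (sqrt 3 / 2 * η) + c * sin (sqrt 3 / 2 * η))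

/-- `√3 · √3 = 3`. -/
theorem sqrt_three_mul_self : sqrt 3 * sqrt 3 = (3 : ℝ) :=
  Real.mul_self_sqrt (by norm_num)

/-- The family is closed under differentiation: the derivative of the member `(a, b, c)` is the
member `(a, -b/2 + (√3/2) c, -c/2 - (√3/2) b)`. -/
theorem smoothingHom_hasDerivAt (a b c η : ℝ) :
    HasDerivAt (smoothingHom a b c)
      (smoothingHom a (-b / 2 + sqrt 3 / 2 * c) (-c / 2 - sqrt 3 / 2 * b) η) η := by
  have h1 : HasDerivAt (fun x => a * exp x) (a * exp η) η := (hasDerivAt_exp η).const_mul a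
  have h2 : HasDerivAt (fun x => exp (-x / 2)) (exp (-η / 2) * (-1 / 2)) η :=
    (((hasDerivAt_id' η).neg).div_const 2).exp
  have h3 : HasDerivAt (fun x => cos (sqrt 3 / 2 * x))
      (-sin (sqrt 3 / 2 * η) * (sqrt 3 / 2 * 1)) η :=
    ((hasDerivAt_id' η).const_mul (sqrt 3 / 2)).cos
  have h4 : HasDerivAt (fun x => sin (sqrt 3 / 2 * x))
      (cos (sqrt 3 / 2 * η) * (sqrt 3 / 2 * 1)) η :=
    ((hasDerivAt_id' η).const_mul (sqrt 3 / 2)).sin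
  have h5 : HasDerivAt (fun x => exp (-x / 2) * (b * cos (sqrt 3 / 2 * x) + c * sin (sqrt 3 / 2 * x)))
      (exp (-η / 2) * (-1 / 2) * (b * cos (sqrt 3 / 2 * η) + c * sin (sqrt 3 / 2 * η)) +
        exp (-η / 2) * (b * (-sin (sqrt 3 / 2 * η) * (sqrt 3 / 2 * 1)) +
          c * (cos (sqrt 3 / 2 * η) * (sqrt 3 / 2 * 1)))) η :=
    h2.mul ((h3.const_mul b).add (h4.const_mul c))
  have key : HasDerivAt
      (fun x => a * exp x + exp (-x / 2) * (b * cos (sqrt 3 / 2 * x) + c * sin (sqrt 3 / 2 * x)))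
      (a * exp η + (exp (-η / 2) * (-1 / 2) * (b * cos (sqrt 3 / 2 * η) + c * sin (sqrt 3 / 2 * η)) +
        exp (-η / 2) * (b * (-sin (sqrt 3 / 2 * η) * (sqrt 3 / 2 * 1)) +
          c * (cos (sqrt 3 / 2 * η) * (sqrt 3 / 2 * 1))))) η := h1.add h5
  refine key.congr_deriv ?_
  simp only [smoothingHom]; ring

/-- Derivative of a member with prescribed coefficient names. -/
theorem smoothingHom_hasDerivAt' {a b c b' c' : ℝ} (hb : b' = -b / 2 + sqrt 3 / 2 * c)
    (hc : c' = -c / 2 - sqrt 3 / 2 * b) (η : ℝ) :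
    HasDerivAt (smoothingHom a b c) (smoothingHom a b' c' η) η := by
  subst hb; subst hc; exact smoothingHom_hasDerivAt a b c η

/-- Value of a member at `η = 0`. -/
theorem smoothingHom_zero (a b c : ℝ) : smoothingHom a b c 0 = a + b := by
  simp [smoothingHom]

/-- The vector field of the first-order system `(m, m₁, m₂)' = (m₁, m₂, m)` is a coordinate
permutation, hence `1`-Lipschitz for the sup metric of `ℝ × ℝ × ℝ`. -/
theorem smoothing_field_lipschitz :
    LipschitzWith 1 (fun p : ℝ × ℝ × ℝ => (p.2.1, p.2.2, p.1)) := by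
  refine LipschitzWith.of_dist_le_mul fun p q => ?_
  simp only [Prod.dist_eq, NNReal.coe_one, one_mul]
  refine max_le ?_ (max_le ?_ ?_)
  · exact le_max_of_le_right (le_max_left _ _)
  · exact le_max_of_le_right (le_max_right _ _)
  · exact le_max_left _ _

/-- **Classification (Picard–Lindelöf dimension count).** Every solution of `m''' = m` on `ℝ`
(given as a triple `m' = m₁`, `m₁' = m₂`, `m₂' = m`) is the member of the family with
coefficients read off from `m(0), m'(0), m''(0)`. -/
theorem smoothing_hom_classification {m m₁ m₂ : ℝ → ℝ}
    (h₀ : ∀ η, HasDerivAt m (m₁ η) η) (h₁ : ∀ η, HasDerivAt m₁ (m₂ η) η)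
    (h₂ : ∀ η, HasDerivAt m₂ (m η) η) (η : ℝ) :
    m η = smoothingHom ((m 0 + m₁ 0 + m₂ 0) / 3) ((2 * m 0 - m₁ 0 - m₂ 0) / 3)
      (sqrt 3 * (m₁ 0 - m₂ 0) / 3) η := by
  obtain ⟨a, ha⟩ : ∃ a : ℝ, a = (m 0 + m₁ 0 + m₂ 0) / 3 := ⟨_, rfl⟩
  obtain ⟨b, hb⟩ : ∃ b : ℝ, b = (2 * m 0 - m₁ 0 - m₂ 0) / 3 := ⟨_, rfl⟩
  obtain ⟨c, hc⟩ : ∃ c : ℝ, c = sqrt 3 * (m₁ 0 - m₂ 0) / 3 := ⟨_, rfl⟩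
  rw [← ha, ← hb, ← hc]
  have hs : sqrt 3 * sqrt 3 = (3 : ℝ) := sqrt_three_mul_self
  -- the derived coefficients (first and second derivative members)
  obtain ⟨b₁, hb₁⟩ : ∃ b₁ : ℝ, b₁ = -b / 2 + sqrt 3 / 2 * c := ⟨_, rfl⟩
  obtain ⟨c₁, hc₁⟩ : ∃ c₁ : ℝ, c₁ = -c / 2 - sqrt 3 / 2 * b := ⟨_, rfl⟩
  obtain ⟨b₂, hb₂⟩ : ∃ b₂ : ℝ, b₂ = -b₁ / 2 + sqrt 3 / 2 * c₁ := ⟨_, rfl⟩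
  obtain ⟨c₂, hc₂⟩ : ∃ c₂ : ℝ, c₂ = -c₁ / 2 - sqrt 3 / 2 * b₁ := ⟨_, rfl⟩
  -- the coefficient map has order three (uses `√3 · √3 = 3`)
  have hb₃ : b = -b₂ / 2 + sqrt 3 / 2 * c₂ := by
    rw [hb₂, hc₂, hb₁, hc₁]; linear_combination ((sqrt 3 * c - 3 * b) / 8) * hs
  have hc₃ : c = -c₂ / 2 - sqrt 3 / 2 * b₂ := by
    rw [hb₂, hc₂, hb₁, hc₁]; linear_combination ((-3 * c - sqrt 3 * b) / 8) * hs
  -- the two trajectories of the first-order system `(m, m₁, m₂)' = (m₁, m₂, m)`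
  let f : ℝ → ℝ × ℝ × ℝ := fun t => (m t, m₁ t, m₂ t)
  let g : ℝ → ℝ × ℝ × ℝ := fun t =>
    (smoothingHom a b c t, smoothingHom a b₁ c₁ t, smoothingHom a b₂ c₂ t)
  have hf : ∀ t, HasDerivAt f ((f t).2.1, (f t).2.2, (f t).1) t ∧
      f t ∈ (univ : Set (ℝ × ℝ × ℝ)) :=
    fun t => ⟨(h₀ t).prodMk ((h₁ t).prodMk (h₂ t)), mem_univ _⟩
  have hg : ∀ t, HasDerivAt g ((g t).2.1, (g t).2.2, (g t).1) t ∧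
      g t ∈ (univ : Set (ℝ × ℝ × ℝ)) :=
    fun t => ⟨(smoothingHom_hasDerivAt' hb₁ hc₁ t).prodMk
      ((smoothingHom_hasDerivAt' hb₂ hc₂ t).prodMk (smoothingHom_hasDerivAt' hb₃ hc₃ t)),
      mem_univ _⟩
  -- initial data agree at `η = 0`
  have e1 : m 0 = smoothingHom a b c 0 := by
    rw [smoothingHom_zero, ha, hb]; ring
  have e2 : m₁ 0 = smoothingHom a b₁ c₁ 0 := by
    rw [smoothingHom_zero, hb₁, ha, hb, hc]
    linear_combination (-(m₁ 0 - m₂ 0) / 6) * hs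
  have e3 : m₂ 0 = smoothingHom a b₂ c₂ 0 := by
    rw [smoothingHom_zero, hb₂, hb₁, hc₁, ha, hb, hc]
    linear_combination ((m₁ 0 - m₂ 0) / 6 + (2 * m 0 - m₁ 0 - m₂ 0) / 12) * hs
  have h0 : f 0 = g 0 := by
    simp only [f, g, e1.symm, e2.symm, e3.symm]
  have hfg : f = g :=
    ODE_solution_unique_univ (v := fun _ p => (p.2.1, p.2.2, p.1)) (s := fun _ => univ)
      (fun _ => smoothing_field_lipschitz.lipschitzOnWith) hf hg h0
  have := congrArg (fun F => (F η).1) hfg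
  simpa [f, g] using this

/-- **A bounded solution of `m''' = m` on `ℝ` is identically zero** (kernel #113 part B made
unconditional). -/
theorem smoothing_hom_bounded_solution_zero {m m₁ m₂ : ℝ → ℝ}
    (h₀ : ∀ η, HasDerivAt m (m₁ η) η) (h₁ : ∀ η, HasDerivAt m₁ (m₂ η) η)
    (h₂ : ∀ η, HasDerivAt m₂ (m η) η) (hM : ∃ M : ℝ, ∀ η, |m η| ≤ M) (η : ℝ) : m η = 0 := by
  have hcl := smoothing_hom_classification h₀ h₁ h₂
  obtain ⟨M, hM⟩ := hM
  have hfam : ∃ M : ℝ, ∀ η : ℝ,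
      |(m 0 + m₁ 0 + m₂ 0) / 3 * exp η + exp (-η / 2) * ((2 * m 0 - m₁ 0 - m₂ 0) / 3 *
        cos (sqrt 3 / 2 * η) + sqrt 3 * (m₁ 0 - m₂ 0) / 3 * sin (sqrt 3 / 2 * η))| ≤ M := by
    refine ⟨M, fun η => ?_⟩
    have := hM η
    rwa [hcl η, smoothingHom] at this
  obtain ⟨ha, hb, hc⟩ := smoothing_hom_bounded_zero hfam
  rw [hcl η, smoothingHom, ha, hb, hc]; simp

/-- **Uniqueness of the bounded inverse of `1 - ∂³`.** Two bounded solutions `p, q` of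
`m - m''' = g` on `ℝ` (third derivatives `p - g`, `q - g`) coincide. With kernel #112 (the bounded
Green's function) this is the well-posedness of the third-order join rule in `L^∞`. -/
theorem smoothing_bounded_inverse_unique {p p₁ p₂ q q₁ q₂ g : ℝ → ℝ}
    (hp₀ : ∀ η, HasDerivAt p (p₁ η) η) (hp₁ : ∀ η, HasDerivAt p₁ (p₂ η) η)
    (hp₂ : ∀ η, HasDerivAt p₂ (p η - g η) η)
    (hq₀ : ∀ η, HasDerivAt q (q₁ η) η) (hq₁ : ∀ η, HasDerivAt q₁ (q₂ η) η)
    (hq₂ : ∀ η, HasDerivAt q₂ (q η - g η) η)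
    (hp : ∃ M : ℝ, ∀ η, |p η| ≤ M) (hq : ∃ M : ℝ, ∀ η, |q η| ≤ M) : p = q := by
  obtain ⟨Mp, hMp⟩ := hp
  obtain ⟨Mq, hMq⟩ := hq
  have hd₂ : ∀ η, HasDerivAt (fun x => p₂ x - q₂ x) (p η - q η) η :=
    fun η => ((hp₂ η).sub (hq₂ η)).congr_deriv (by ring)
  have hz := smoothing_hom_bounded_solution_zero (m := fun x => p x - q x)
    (m₁ := fun x => p₁ x - q₁ x) (m₂ := fun x => p₂ x - q₂ x)
    (fun η => (hp₀ η).sub (hq₀ η)) (fun η => (hp₁ η).sub (hq₁ η)) hd₂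
    ⟨Mp + Mq, fun η => (abs_sub _ _).trans (add_le_add (hMp η) (hMq η))⟩
  funext η
  exact sub_eq_zero.mp (hz η)

/-- Existence with prescribed data: the member with the classification coefficients of
`(x, y, z)` takes the values `x`, `y`, `z` together with its first and second derivative members
at `η = 0` (so the solution space of the third-order equation on `ℝ` is exactly the family). -/
theorem smoothingHom_initial_data (x y z : ℝ) :
    smoothingHom ((x + y + z) / 3) ((2 * x - y - z) / 3) (sqrt 3 * (y - z) / 3) 0 = x ∧
      smoothingHom ((x + y + z) / 3)
          (-((2 * x - y - z) / 3) / 2 + sqrt 3 / 2 * (sqrt 3 * (y - z) / 3))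
          (-(sqrt 3 * (y - z) / 3) / 2 - sqrt 3 / 2 * ((2 * x - y - z) / 3)) 0 = y ∧
      smoothingHom ((x + y + z) / 3)
          (-(-((2 * x - y - z) / 3) / 2 + sqrt 3 / 2 * (sqrt 3 * (y - z) / 3)) / 2 +
            sqrt 3 / 2 * (-(sqrt 3 * (y - z) / 3) / 2 - sqrt 3 / 2 * ((2 * x - y - z) / 3)))
          (-(-(sqrt 3 * (y - z) / 3) / 2 - sqrt 3 / 2 * ((2 * x - y - z) / 3)) / 2 -
            sqrt 3 / 2 * (-((2 * x - y - z) / 3) / 2 + sqrt 3 / 2 * (sqrt 3 * (y - z) / 3))) 0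
        = z := by
  have hs : sqrt 3 * sqrt 3 = (3 : ℝ) := sqrt_three_mul_self
  refine ⟨?_, ?_, ?_⟩
  · rw [smoothingHom_zero]; ring
  · rw [smoothingHom_zero]; linear_combination ((y - z) / 6) * hs
  · rw [smoothingHom_zero]; linear_combination ((-2 * x - y + 3 * z) / 12) * hs

end Summit.AnomalousDissipation.AnomalousDissipation.Theorems
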